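import Literature.Barriers.CriticalPhenomena.FKParafermionicHalfCauchyRiemann
import Literature.Probability.LatticeModels.MedialWinding
import Literature.Probability.RandomPlanarGeometry.PlanarDomains
import HarnessLib

/-!
# Sketch — crux-ideate round 2, ideator 5, crux stmt-CriticalPhenomena-11389
(`CardyComplexCone.ParafermionToSLESixFamilies`)

First lemmas of the two idea cards `bergman-split-sum-rules` and `flip-involution-return-law`.
All four are `def … : Prop` (statements only; they must elaborate, not be proved here).
-/

noncomputable section

namespace Summit.CriticalPhenomena.CardyFormulaZ2.Cruxes.ParafermionToSLESixFamilies.Ideator5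

open Literature.Probability.LatticeModels
open Literature.Barriers.CriticalPhenomena
open Literature.Barriers.CriticalPhenomena.HalfCRGreen

/-- Position (lattice units, mesh 1) of the medial vertex indexed by `(x, i)` = midpoint of the lattice
edge from `x` to `x + eᵢ`. -/
def medialPos (p : Site 2 × Fin 2) : ℂ :=
  ((p.1 0 : ℤ) : ℂ) + ((p.1 1 : ℤ) : ℂ) * Complex.I +
    (if p.2 = 0 then (1 / 2 : ℂ) else Complex.I / 2)

/-- FIRST LEMMA A1 (Bergman split, anti-analytic half). In the landed weighted Green identity
`sum_weighted_halfCRForm_eq` (Theorems/…IicWeightedGreen), the interior coefficient of the corner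
`k` at the medial vertex `(x,i)` is `coeff c k * (ψ (x,i) - ψ (twin x i k))`. For the ANTIHOLOMORPHIC
linear weight `ψ = conj ∘ medialPos` and the critical coefficient `c = I` it is the SAME constant
`(1 + I)/2` for all four corners: the interior pairing sees only the class-symmetric corner sum, i.e.
the crux's VERTEX observable, and no staggered mode. (Finite check: `fin_cases i <;> fin_cases k`.) -/
def BergmanSplitAnti : Prop :=
  ∀ (x : Site 2) (i : Fin 2) (k : Fin 4),
    coeff Complex.I k *
        ((starRingEnd ℂ) (medialPos (x, i)) - (starRingEnd ℂ) (medialPos (twin x i k))) =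
      (1 + Complex.I) / 2

/-- FIRST LEMMA A2 (Bergman split, analytic half). For the HOLOMORPHIC linear weight
`ψ = medialPos` the interior coefficient alternates, `(1 - I)/2 · (-1)^k`: the interior pairing sees
only the diagonal-staggered mode `Σ_k (-1)^k F(corner k)` and no vertex observable. -/
def BergmanSplitHol : Prop :=
  ∀ (x : Site 2) (i : Fin 2) (k : Fin 4),
    coeff Complex.I k * (medialPos (x, i) - medialPos (twin x i k)) =
      (1 - Complex.I) / 2 * (-1 : ℂ) ^ (k : ℕ)

/-- FIRST LEMMA B1 (double-passage winding). If the exploration path of admissible data passes a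
medial vertex twice (positions `k < k'`), the two bisected windings differ by exactly `±π`
(the return loop is non-self-crossing: Umlaufsatz; the second turn equals the first). Numerically
exact in 10⁷ sampled returns (scratch/hull_mc.py, L = 8…128). -/
def DoublePassageWinding : Prop :=
  ∀ (E : DiscreteDobrushin) (ω : Literature.Probability.Percolation.BondConfig (Site 2)) (k k' : ℕ),
    E.IsZdAdmissible → k < k' → k' < (medialExploration E ω).length →
    (medialExploration E ω)[k]? = (medialExploration E ω)[k']? →
      MedialPath.windingAt (medialExploration E ω) E.δ k' -
            MedialPath.windingAt (medialExploration E ω) E.δ k = Real.pi ∨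
        MedialPath.windingAt (medialExploration E ω) E.δ k' -
            MedialPath.windingAt (medialExploration E ω) E.δ k = -Real.pi

/-- FIRST LEMMA B2 (flip involution ⇒ fair return). On a Jordan carrier, for every lattice edge `z`
whose state is effective after the boundary conditions (flipping it changes `bcBondConfig` at `z`)
and which the exploration path of `ω` passes, EXACTLY ONE of `ω`, `ω Δ {z}` makes the path pass `z`
twice: the prefix up to the first arrival at `z` does not examine `z`, and the far endpoint of `z`
is either already joined to the explored cluster avoiding `z` (then `z` closed ⇒ the path enters the
enclosed pocket and returns, `z` open ⇒ it does not) or pendant (then `z` open ⇒ the path surrounds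
the pendant cluster and returns, `z` closed ⇒ it does not). Hence `P(return ∣ past) = 1/2`
deterministically; MC: return fraction 0.5029, 0.5010, 0.4996, 0.5003, 0.5008 at L = 8,16,32,64,128
and the PHASE-WEIGHTED return ratio 0.5028, 0.5008, 0.4997, 0.5003, 0.5002 (real). -/
def FlipInvolutionReturn : Prop :=
  ∀ (D : Literature.Probability.RandomPlanarGeometry.DobrushinDomain) (E : DiscreteDobrushin)
    (ω : Literature.Probability.Percolation.BondConfig (Site 2)) (z : MedialVertex),
    E.Ω = D.carrier → E.IsZdAdmissible →
    ¬ (z ∈ E.bcBondConfig ω ↔ z ∈ E.bcBondConfig (symmDiff ω {z})) →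
    z ∈ medialExploration E ω →
      (medialExploration E ω).count z + (medialExploration E (symmDiff ω {z})).count z = 3

end Summit.CriticalPhenomena.CardyFormulaZ2.Cruxes.ParafermionToSLESixFamilies.Ideator5
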